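import Summits.Parity.BatemanHorn.Theorems.SoloInformedTwinBoxCount

/-!
# The unbalanced twin sum, regime (1b) — IV: summing the trivial classes

Soloist file (informed mode), file F4c-β of the kernel project for (F′).  We sum the three
trivially bounded classes of the pointwise classification `abs_boxSum_le_classes` over all boxes
`(i, l)` and all moduli `q ∈ Q ⊆ [1, z]` (`M = boxLow_i`, `N = boxLow_l`, `L_hi = log hi`,
`0 < Δ ≤ 1`, `ΔK₀ ≥ 2`, `1 ≤ z`, `z² ≤ y`, `I'` rows):

* class T (small product `MN < V`):  `≤ 4 V L_hi^j (Δ I' (1 + log z) + 8/Δ)`;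
* class P (cut boxes, at most one row per modulus):  `≤ 4 hi L_hi^j (Δ (1 + log z) + 4 z²/y)`;
* class H (hyperbola boxes, at most two per row):  `≤ 4 hi L_hi^j (Δ² I' (1 + log z) + 8 z²/y)`.

The cofactor sums are geometric (`sum_boxLow_indicator_le`), the row sums of `1/N` are geometric
(`sum_inv_boxLow_indicator_le`), and the modulus sums are harmonic.
-/

namespace Summit.Parity.BatemanHorn.Theorems

open Finset Real
open scoped ArithmeticFunction.Moebius
open Literature.NumberTheory.Sieve Literature.NumberTheory.Sieve.BFI

/-! ### 1. Small facts -/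

/-- Harmonic sum over a subset of `[1, z]`: `∑_{q ∈ Q} 1/q ≤ 1 + log z`. -/
theorem sum_one_div_le_of_subset_Icc {z : ℕ} {Q : Finset ℕ} (hQ : Q ⊆ Icc 1 z) :
    ∑ q ∈ Q, (1 : ℝ) / q ≤ 1 + Real.log z := by
  calc ∑ q ∈ Q, (1 : ℝ) / q ≤ ∑ q ∈ Icc 1 z, (1 : ℝ) / q :=
        Finset.sum_le_sum_of_subset_of_nonneg hQ fun q _ _ => by positivity
    _ ≤ 1 + Real.log z := by
        have h := harmonic_le_one_add_log z
        rw [harmonic_eq_sum_Icc] at h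
        push_cast at h
        simpa only [one_div] using h

/-- `∑_{q ∈ Q} q ≤ z²` for `Q ⊆ [1, z]`. -/
theorem sum_self_le_sq_of_subset_Icc {z : ℕ} {Q : Finset ℕ} (hQ : Q ⊆ Icc 1 z) :
    ∑ q ∈ Q, (q : ℝ) ≤ (z : ℝ) ^ 2 := by
  calc ∑ q ∈ Q, (q : ℝ) ≤ ∑ q ∈ Icc 1 z, (q : ℝ) :=
        Finset.sum_le_sum_of_subset_of_nonneg hQ fun q _ _ => by positivity
    _ ≤ ∑ q ∈ Icc 1 z, (z : ℝ) :=
        Finset.sum_le_sum fun q hq => by exact_mod_cast (Finset.mem_Icc.1 hq).2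
    _ = (z : ℝ) ^ 2 := by rw [Finset.sum_const, Nat.card_Icc, nsmul_eq_mul]; push_cast; ring

/-- `#Q ≤ z` for `Q ⊆ [1, z]`, in `ℝ`. -/
theorem card_le_of_subset_Icc {z : ℕ} {Q : Finset ℕ} (hQ : Q ⊆ Icc 1 z) : (#Q : ℝ) ≤ z := by
  have h := Finset.card_le_card hQ
  rw [Nat.card_Icc] at h
  exact_mod_cast (h.trans (by omega))

/-- Monotonicity of an indicator-weighted nonnegative value in its condition. -/
theorem ite_le_ite_of_imp {p p' : Prop} [Decidable p] [Decidable p'] (h : p → p') {v : ℝ}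
    (hv : 0 ≤ v) : (if p then v else 0) ≤ (if p' then v else 0) := by
  split_ifs with h1 h2
  · exact le_rfl
  · exact absurd (h h1) h2
  · exact hv
  · exact le_rfl

/-- A contributing cofactor box has `ΔM ≥ 1` (`K₀ < boxHigh_i = (1+Δ)M ≤ 2M`, `ΔK₀ ≥ 2`). -/
theorem one_le_mul_boxLow_of_lt {Δ : ℝ} (hΔ : 0 < Δ) (hΔ1 : Δ ≤ 1) {K K₀ i : ℕ}
    (hK₀ : 2 ≤ Δ * K₀) (h : (K₀ : ℝ) < boxHigh (K : ℝ) Δ i) : 1 ≤ Δ * boxLow (K : ℝ) Δ i := by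
  rw [boxHigh_eq_mul_boxLow (by linarith)] at h
  have h1 : 0 < 1 + Δ := by linarith
  have hM : 0 ≤ boxLow (K : ℝ) Δ i := by unfold boxLow; positivity
  have h2 := mul_lt_mul_of_pos_left h hΔ
  have h3 : Δ * ((1 + Δ) * boxLow (K : ℝ) Δ i) ≤ 2 * (Δ * boxLow (K : ℝ) Δ i) := by
    nlinarith [mul_nonneg hΔ.le hM]
  linarith

/-- The trivial box bound in a contributing cofactor box: `boxTriv ≤ 2ΔM · L_hi^j (ΔN/q + 1)`. -/
theorem boxTriv_le_of_lt {Δ : ℝ} (hΔ : 0 < Δ) (hΔ1 : Δ ≤ 1) {K K₀ i : ℕ} (hK₀ : 2 ≤ Δ * K₀)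
    (h : (K₀ : ℝ) < boxHigh (K : ℝ) Δ i) (j hi q l : ℕ) :
    boxTriv j hi K Δ q i l ≤ 2 * Δ * boxLow (K : ℝ) Δ i *
      (Real.log hi ^ j * (Δ * boxLow (hi : ℝ) Δ l / q + 1)) := by
  have h1 := one_le_mul_boxLow_of_lt hΔ hΔ1 hK₀ h
  have hΔ' : (-1 : ℝ) < Δ := by linarith
  have h0 : 0 < 1 + Δ := by linarith
  unfold boxTriv
  rw [boxHigh_eq_mul_boxLow hΔ' i, boxHigh_eq_mul_boxLow hΔ' l]
  have hN : 0 ≤ boxLow (hi : ℝ) Δ l := by unfold boxLow; positivity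
  have hL : 0 ≤ Real.log hi ^ j * (Δ * boxLow (hi : ℝ) Δ l / q + 1) := by
    have := Real.log_natCast_nonneg hi; positivity
  have e : ((1 + Δ) * boxLow (hi : ℝ) Δ l - boxLow (hi : ℝ) Δ l) / q + 1 =
      Δ * boxLow (hi : ℝ) Δ l / q + 1 := by ring
  rw [e]
  calc Real.log hi ^ j * ((1 + Δ) * boxLow (K : ℝ) Δ i - boxLow (K : ℝ) Δ i + 1) *
        (Δ * boxLow (hi : ℝ) Δ l / q + 1)
      = (Δ * boxLow (K : ℝ) Δ i + 1) * (Real.log hi ^ j * (Δ * boxLow (hi : ℝ) Δ l / q + 1)) := by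
        ring
    _ ≤ (2 * Δ * boxLow (K : ℝ) Δ i) * (Real.log hi ^ j * (Δ * boxLow (hi : ℝ) Δ l / q + 1)) :=
        mul_le_mul_of_nonneg_right (by linarith) hL
    _ = _ := by ring

/-- A box whose top exceeds `1` and the cut `c_q = ⌊y/q⌋`: `y/(4q) < N` (`0 < Δ ≤ 1`, `q ≥ 1`). -/
theorem boxLow_gt_of_cut {Δ : ℝ} (hΔ : 0 < Δ) (hΔ1 : Δ ≤ 1) {q : ℕ} (hq : 0 < q) {hi y l : ℕ}
    (h1 : 1 ≤ boxHigh (hi : ℝ) Δ l) (h2 : ((y / q : ℕ) : ℝ) < boxHigh (hi : ℝ) Δ l) :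
    (y : ℝ) / (4 * q) < boxLow (hi : ℝ) Δ l := by
  have h0 : 0 < 1 + Δ := by linarith
  have hN0 : 0 ≤ boxLow (hi : ℝ) Δ l := by unfold boxLow; positivity
  rw [boxHigh_eq_mul_boxLow (show (-1 : ℝ) < Δ by linarith)] at h1 h2
  have hy : (y : ℝ) < q * (((y / q : ℕ) : ℝ) + 1) := by exact_mod_cast Nat.lt_mul_div_succ y hq
  have hq' : (0 : ℝ) < q := by exact_mod_cast hq
  set N := boxLow (hi : ℝ) Δ l
  have hA : (1 + Δ) * N ≤ 2 * N := by nlinarith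
  have hB : ((y / q : ℕ) : ℝ) + 1 ≤ 4 * N := by linarith
  rw [div_lt_iff₀ (by positivity)]
  nlinarith [mul_le_mul_of_nonneg_left hB hq'.le]

/-- An uncut box (`c_q ≤ N`) with `q ≤ y`: `y/(2q) < N`. -/
theorem boxLow_gt_of_uncut {q y : ℕ} (hq : 0 < q) (hqy : q ≤ y) {Δ : ℝ} {hi l : ℕ}
    (h : ((y / q : ℕ) : ℝ) ≤ boxLow (hi : ℝ) Δ l) : (y : ℝ) / (2 * q) < boxLow (hi : ℝ) Δ l := by
  have hc1 : 0 < y / q := Nat.div_pos hqy hq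
  have hy : y < q * (y / q + 1) := Nat.lt_mul_div_succ y hq
  have hy2 : y < 2 * q * (y / q) := by nlinarith
  have hy2' : (y : ℝ) < 2 * q * ((y / q : ℕ) : ℝ) := by exact_mod_cast hy2
  have hq' : (0 : ℝ) < q := by exact_mod_cast hq
  rw [div_lt_iff₀ (by positivity)]
  nlinarith

/-! ### 2. Cofactor sums -/

/-- **Cofactor sum of a trivially bounded class** (T and P): for `W ≥ 0` and a condition `R` not
depending on `i`, `∑_{i<I} 𝟙[(K₀ < boxHigh_i ∧ M_i N ≤ W) ∧ R] boxTriv ≤ 𝟙[R] 4 W L_hi^j (Δ/q + 1/N)`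
(geometric cofactor sum `sum_boxLow_indicator_le`). -/
theorem sum_boxTriv_le_of_prod_le {Δ : ℝ} (hΔ : 0 < Δ) (hΔ1 : Δ ≤ 1) {K K₀ : ℕ}
    (hK₀ : 2 ≤ Δ * K₀) {hi : ℕ} (hhi : 0 < hi) {q : ℕ} (hq : 0 < q) {W : ℝ} (hW : 0 ≤ W)
    (R : Prop) [Decidable R] (j l I : ℕ) :
    ∑ i ∈ range I, (if ((K₀ : ℝ) < boxHigh (K : ℝ) Δ i ∧
        boxLow (K : ℝ) Δ i * boxLow (hi : ℝ) Δ l ≤ W) ∧ R then boxTriv j hi K Δ q i l else 0) ≤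
      if R then 4 * W * Real.log hi ^ j * (Δ / q + 1 / boxLow (hi : ℝ) Δ l) else 0 := by
  have hNpos : 0 < boxLow (hi : ℝ) Δ l := boxLow_pos (by exact_mod_cast hhi) (by linarith) l
  have hq' : (0 : ℝ) < q := by exact_mod_cast hq
  set N := boxLow (hi : ℝ) Δ l with hN
  set E := Real.log hi ^ j * (Δ * N / q + 1) with hE
  have hE0 : 0 ≤ E := by have := Real.log_natCast_nonneg hi; positivity
  by_cases hR : R
  · rw [if_pos hR]
    have hterm : ∀ i ∈ range I, (if ((K₀ : ℝ) < boxHigh (K : ℝ) Δ i ∧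
        boxLow (K : ℝ) Δ i * N ≤ W) ∧ R then boxTriv j hi K Δ q i l else 0) ≤
        (if boxLow (K : ℝ) Δ i ≤ W / N then boxLow (K : ℝ) Δ i else 0) * (2 * Δ * E) := by
      intro i _
      have hM0 : 0 ≤ boxLow (K : ℝ) Δ i := by
        unfold boxLow; have : 0 < 1 + Δ := by linarith
        positivity
      split_ifs with h1 h2
      · calc boxTriv j hi K Δ q i l ≤ 2 * Δ * boxLow (K : ℝ) Δ i * E :=
              boxTriv_le_of_lt hΔ hΔ1 hK₀ h1.1.1 j hi q l
          _ = boxLow (K : ℝ) Δ i * (2 * Δ * E) := by ring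
      · exact absurd ((le_div_iff₀ hNpos).2 h1.1.2) h2
      · positivity
      · simp
    calc ∑ i ∈ range I, (if ((K₀ : ℝ) < boxHigh (K : ℝ) Δ i ∧ boxLow (K : ℝ) Δ i * N ≤ W) ∧ R
            then boxTriv j hi K Δ q i l else 0)
        ≤ ∑ i ∈ range I, (if boxLow (K : ℝ) Δ i ≤ W / N then boxLow (K : ℝ) Δ i else 0) *
            (2 * Δ * E) := Finset.sum_le_sum hterm
      _ = (∑ i ∈ range I, (if boxLow (K : ℝ) Δ i ≤ W / N then boxLow (K : ℝ) Δ i else 0)) *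
            (2 * Δ * E) := by rw [Finset.sum_mul]
      _ ≤ ((1 + Δ) * (W / N) / Δ) * (2 * Δ * E) :=
          mul_le_mul_of_nonneg_right
            (sum_boxLow_indicator_le (Nat.cast_nonneg K) hΔ (div_nonneg hW hNpos.le) I)
            (by positivity)
      _ = 2 * (1 + Δ) * ((W / N) * E) := by field_simp
      _ ≤ 4 * ((W / N) * E) := by
          have : 0 ≤ (W / N) * E := by positivity
          nlinarith
      _ = 4 * W * Real.log hi ^ j * (Δ / q + 1 / N) := by
          rw [hE]; field_simp
  · rw [if_neg hR]
    refine (Finset.sum_eq_zero fun i _ => ?_).le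
    rw [if_neg (fun h => hR h.2)]

/-- **Cofactor sum of the hyperbola class** (H): with `R` not depending on `i`,
`∑_{i<I} 𝟙[(K₀ < boxHigh_i ∧ M_i N ≤ hi < (1+Δ)² M_i N) ∧ R] boxTriv ≤ 𝟙[R] 4Δ hi L_hi^j (Δ/q + 1/N)`
(at most two such `i`, `card_filter_hyper_le_two`). -/
theorem sum_boxTriv_hyper_le {Δ : ℝ} (hΔ : 0 < Δ) (hΔ1 : Δ ≤ 1) {K K₀ : ℕ} (hK₀ : 2 ≤ Δ * K₀)
    {hi : ℕ} (hhi : 0 < hi) {q : ℕ} (hq : 0 < q) (R : Prop) [Decidable R] (j l I : ℕ) :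
    ∑ i ∈ range I, (if ((K₀ : ℝ) < boxHigh (K : ℝ) Δ i ∧
        boxLow (K : ℝ) Δ i * boxLow (hi : ℝ) Δ l ≤ hi ∧
        (hi : ℝ) < (1 + Δ) ^ 2 * (boxLow (K : ℝ) Δ i * boxLow (hi : ℝ) Δ l)) ∧ R
        then boxTriv j hi K Δ q i l else 0) ≤
      if R then 4 * Δ * hi * Real.log hi ^ j * (Δ / q + 1 / boxLow (hi : ℝ) Δ l) else 0 := by
  have hNpos : 0 < boxLow (hi : ℝ) Δ l := boxLow_pos (by exact_mod_cast hhi) (by linarith) l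
  have hq' : (0 : ℝ) < q := by exact_mod_cast hq
  have hL : 0 ≤ Real.log hi ^ j := pow_nonneg (Real.log_natCast_nonneg hi) j
  rcases Nat.eq_zero_or_pos K with hK0 | hKpos
  · -- no cofactor box contributes when `K = 0`
    subst hK0
    refine (Finset.sum_eq_zero fun i _ => ?_).le.trans (by split_ifs <;> positivity)
    rw [if_neg]
    rintro ⟨⟨h, -⟩, -⟩
    unfold boxHigh at h
    simp only [Nat.cast_zero, zero_div] at h
    exact absurd h (by exact_mod_cast Nat.not_lt_zero K₀)
  set N := boxLow (hi : ℝ) Δ l with hN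
  set E := Real.log hi ^ j * (Δ * N / q + 1) with hE
  have hE0 : 0 ≤ E := by positivity
  by_cases hR : R
  · rw [if_pos hR]
    have hterm : ∀ i ∈ range I, (if ((K₀ : ℝ) < boxHigh (K : ℝ) Δ i ∧
        boxLow (K : ℝ) Δ i * N ≤ hi ∧ (hi : ℝ) < (1 + Δ) ^ 2 * (boxLow (K : ℝ) Δ i * N)) ∧ R
        then boxTriv j hi K Δ q i l else 0) ≤
        (if boxLow (K : ℝ) Δ i ≤ hi / N ∧ (hi : ℝ) / N < (1 + Δ) ^ 2 * boxLow (K : ℝ) Δ i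
          then (1 : ℝ) else 0) * (2 * Δ * (hi / N) * E) := by
      intro i _
      split_ifs with h1 h2
      · rw [one_mul]
        calc boxTriv j hi K Δ q i l ≤ 2 * Δ * boxLow (K : ℝ) Δ i * E :=
              boxTriv_le_of_lt hΔ hΔ1 hK₀ h1.1.1 j hi q l
          _ ≤ 2 * Δ * (hi / N) * E := by
              have : boxLow (K : ℝ) Δ i ≤ hi / N := (le_div_iff₀ hNpos).2 h1.1.2.1
              have : 2 * Δ * boxLow (K : ℝ) Δ i ≤ 2 * Δ * (hi / N) := by nlinarith
              exact mul_le_mul_of_nonneg_right this hE0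
      · exfalso; refine h2 ⟨(le_div_iff₀ hNpos).2 h1.1.2.1, ?_⟩
        rw [div_lt_iff₀ hNpos]
        calc (hi : ℝ) < (1 + Δ) ^ 2 * (boxLow (K : ℝ) Δ i * N) := h1.1.2.2
          _ = (1 + Δ) ^ 2 * boxLow (K : ℝ) Δ i * N := by ring
      · positivity
      · simp
    calc ∑ i ∈ range I, (if ((K₀ : ℝ) < boxHigh (K : ℝ) Δ i ∧ boxLow (K : ℝ) Δ i * N ≤ hi ∧
            (hi : ℝ) < (1 + Δ) ^ 2 * (boxLow (K : ℝ) Δ i * N)) ∧ R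
            then boxTriv j hi K Δ q i l else 0)
        ≤ ∑ i ∈ range I, (if boxLow (K : ℝ) Δ i ≤ hi / N ∧
            (hi : ℝ) / N < (1 + Δ) ^ 2 * boxLow (K : ℝ) Δ i then (1 : ℝ) else 0) *
            (2 * Δ * (hi / N) * E) := Finset.sum_le_sum hterm
      _ = (#((range I).filter (fun i => boxLow (K : ℝ) Δ i ≤ hi / N ∧
            (hi : ℝ) / N < (1 + Δ) ^ 2 * boxLow (K : ℝ) Δ i)) : ℝ) * (2 * Δ * (hi / N) * E) := by
          rw [← Finset.sum_mul, Finset.sum_boole]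
      _ ≤ 2 * (2 * Δ * (hi / N) * E) := by
          refine mul_le_mul_of_nonneg_right ?_ (by positivity)
          exact_mod_cast card_filter_hyper_le_two (T := (K : ℝ)) (by exact_mod_cast hKpos) hΔ.le
            ((hi : ℝ) / N) (range I)
      _ = 4 * Δ * hi * Real.log hi ^ j * (Δ / q + 1 / N) := by
          rw [hE]; field_simp; ring
  · rw [if_neg hR]
    refine (Finset.sum_eq_zero fun i _ => ?_).le
    rw [if_neg (fun h => hR h.2)]

/-! ### 3. Row sums -/

/-- Generic row sum: if the row condition `P l` forces `c < N_l` (`c > 0`), then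
`∑_{l<I'} 𝟙[P l] C (Δ/q + 1/N_l) ≤ C (Δ I'/q + (1+Δ)/(Δ c))` (`sum_inv_boxLow_indicator_le`). -/
theorem sum_row_le_of_imp {Δ : ℝ} (hΔ : 0 < Δ) {hi : ℕ} (hhi : 0 < hi) (q : ℕ) {c C : ℝ}
    (hc : 0 < c) (hC : 0 ≤ C) (P : ℕ → Prop) [DecidablePred P]
    (hP : ∀ l, P l → c < boxLow (hi : ℝ) Δ l) (I' : ℕ) :
    ∑ l ∈ range I', (if P l then C * (Δ / q + 1 / boxLow (hi : ℝ) Δ l) else 0) ≤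
      C * (Δ * I' / q + (1 + Δ) / (Δ * c)) := by
  have hterm : ∀ l ∈ range I', (if P l then C * (Δ / q + 1 / boxLow (hi : ℝ) Δ l) else 0) ≤
      C * (Δ / q) + C * (if c < boxLow (hi : ℝ) Δ l then 1 / boxLow (hi : ℝ) Δ l else 0) := by
    intro l _
    have hN : 0 < boxLow (hi : ℝ) Δ l := boxLow_pos (by exact_mod_cast hhi) (by linarith) l
    split_ifs with h1 h2
    · rw [mul_add]
    · exact absurd (hP l h1) h2
    · exact add_nonneg (mul_nonneg hC (div_nonneg hΔ.le (Nat.cast_nonneg q)))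
        (mul_nonneg hC (one_div_pos.2 hN).le)
    · rw [mul_zero, add_zero]; exact mul_nonneg hC (div_nonneg hΔ.le (Nat.cast_nonneg q))
  calc ∑ l ∈ range I', (if P l then C * (Δ / q + 1 / boxLow (hi : ℝ) Δ l) else 0)
      ≤ ∑ l ∈ range I', (C * (Δ / q) +
          C * (if c < boxLow (hi : ℝ) Δ l then 1 / boxLow (hi : ℝ) Δ l else 0)) :=
        Finset.sum_le_sum hterm
    _ = I' * (C * (Δ / q)) +
          C * ∑ l ∈ range I', (if c < boxLow (hi : ℝ) Δ l then 1 / boxLow (hi : ℝ) Δ l else 0) := by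
        rw [Finset.sum_add_distrib, Finset.sum_const, Finset.card_range, nsmul_eq_mul,
          Finset.mul_sum]
    _ ≤ I' * (C * (Δ / q)) + C * ((1 + Δ) / (Δ * c)) :=
        add_le_add le_rfl (mul_le_mul_of_nonneg_left
          (sum_inv_boxLow_indicator_le (T := (hi : ℝ)) (by exact_mod_cast hhi) hΔ hc I') hC)
    _ = C * (Δ * I' / q + (1 + Δ) / (Δ * c)) := by ring

/-- Row sum, class T: `∑_{l<I'} 𝟙[1 ≤ boxHigh_l ∧ c_q < boxHigh_l] C (Δ/q + 1/N_l)
≤ C (Δ I'/q + 8q/(Δ y))` (`C ≥ 0`, `0 < Δ ≤ 1`, `q, y ≥ 1`). -/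
theorem sum_rowT_le {Δ : ℝ} (hΔ : 0 < Δ) (hΔ1 : Δ ≤ 1) {hi : ℕ} (hhi : 0 < hi) {q : ℕ}
    (hq : 0 < q) {y : ℕ} (hy : 0 < y) {C : ℝ} (hC : 0 ≤ C) (I' : ℕ) :
    ∑ l ∈ range I', (if 1 ≤ boxHigh (hi : ℝ) Δ l ∧ ((y / q : ℕ) : ℝ) < boxHigh (hi : ℝ) Δ l
        then C * (Δ / q + 1 / boxLow (hi : ℝ) Δ l) else 0) ≤
      C * (Δ * I' / q + 8 * q / (Δ * y)) := by
  have hq' : (0 : ℝ) < q := by exact_mod_cast hq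
  have hy' : (0 : ℝ) < y := by exact_mod_cast hy
  have h := sum_row_le_of_imp hΔ hhi q (c := (y : ℝ) / (4 * q)) (by positivity) hC
    (fun l => 1 ≤ boxHigh (hi : ℝ) Δ l ∧ ((y / q : ℕ) : ℝ) < boxHigh (hi : ℝ) Δ l)
    (fun l hl => boxLow_gt_of_cut hΔ hΔ1 hq hl.1 hl.2) I'
  have h8 : (1 + Δ) / (Δ * ((y : ℝ) / (4 * q))) ≤ 8 * q / (Δ * y) := by
    rw [div_le_div_iff₀ (by positivity) (by positivity)]
    have e : 8 * q * (Δ * ((y : ℝ) / (4 * q))) = 2 * (Δ * y) := by field_simp; ring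
    rw [e]
    have : 0 < Δ * (y : ℝ) := by positivity
    nlinarith
  calc _ ≤ C * (Δ * I' / q + (1 + Δ) / (Δ * ((y : ℝ) / (4 * q)))) := h
    _ ≤ C * (Δ * I' / q + 8 * q / (Δ * y)) := mul_le_mul_of_nonneg_left (by linarith) hC

/-- Row sum, class H: `∑_{l<I'} 𝟙[c_q ≤ N_l] C (Δ/q + 1/N_l) ≤ C (Δ I'/q + 4q/(Δ y))`
(`C ≥ 0`, `0 < Δ ≤ 1`, `1 ≤ q ≤ y`). -/
theorem sum_rowH_le {Δ : ℝ} (hΔ : 0 < Δ) (hΔ1 : Δ ≤ 1) {hi : ℕ} (hhi : 0 < hi) {q : ℕ}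
    (hq : 0 < q) {y : ℕ} (hqy : q ≤ y) {C : ℝ} (hC : 0 ≤ C) (I' : ℕ) :
    ∑ l ∈ range I', (if ((y / q : ℕ) : ℝ) ≤ boxLow (hi : ℝ) Δ l
        then C * (Δ / q + 1 / boxLow (hi : ℝ) Δ l) else 0) ≤
      C * (Δ * I' / q + 4 * q / (Δ * y)) := by
  have hq' : (0 : ℝ) < q := by exact_mod_cast hq
  have hy' : (0 : ℝ) < y := by exact_mod_cast (lt_of_lt_of_le hq hqy)
  have h := sum_row_le_of_imp hΔ hhi q (c := (y : ℝ) / (2 * q)) (by positivity) hC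
    (fun l => ((y / q : ℕ) : ℝ) ≤ boxLow (hi : ℝ) Δ l)
    (fun l hl => boxLow_gt_of_uncut hq hqy hl) I'
  have h4 : (1 + Δ) / (Δ * ((y : ℝ) / (2 * q))) ≤ 4 * q / (Δ * y) := by
    rw [div_le_div_iff₀ (by positivity) (by positivity)]
    have e : 4 * q * (Δ * ((y : ℝ) / (2 * q))) = 2 * (Δ * y) := by field_simp; ring
    rw [e]
    have : 0 < Δ * (y : ℝ) := by positivity
    nlinarith
  calc _ ≤ C * (Δ * I' / q + (1 + Δ) / (Δ * ((y : ℝ) / (2 * q)))) := h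
    _ ≤ C * (Δ * I' / q + 4 * q / (Δ * y)) := mul_le_mul_of_nonneg_left (by linarith) hC

/-- Row sum, class P: at most one cut row (`card_filter_cut_le_one`) and `1/N < 4q/y` there, so
`∑_{l<I'} 𝟙[1 ≤ boxHigh_l ∧ c_q < boxHigh_l ∧ N_l < c_q] C (Δ/q + 1/N_l) ≤ C (Δ/q + 4q/y)`. -/
theorem sum_rowP_le {Δ : ℝ} (hΔ : 0 < Δ) (hΔ1 : Δ ≤ 1) {hi : ℕ} (hhi : 0 < hi) {q : ℕ}
    (hq : 0 < q) {y : ℕ} (hy : 0 < y) {C : ℝ} (hC : 0 ≤ C) (I' : ℕ) :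
    ∑ l ∈ range I', (if 1 ≤ boxHigh (hi : ℝ) Δ l ∧ ((y / q : ℕ) : ℝ) < boxHigh (hi : ℝ) Δ l ∧
        boxLow (hi : ℝ) Δ l < ((y / q : ℕ) : ℝ)
        then C * (Δ / q + 1 / boxLow (hi : ℝ) Δ l) else 0) ≤ C * (Δ / q + 4 * q / y) := by
  have hq' : (0 : ℝ) < q := by exact_mod_cast hq
  have hy' : (0 : ℝ) < y := by exact_mod_cast hy
  set B := C * (Δ / q + 4 * q / y) with hB
  have hB0 : 0 ≤ B := by positivity
  have hterm : ∀ l ∈ range I', (if 1 ≤ boxHigh (hi : ℝ) Δ l ∧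
      ((y / q : ℕ) : ℝ) < boxHigh (hi : ℝ) Δ l ∧ boxLow (hi : ℝ) Δ l < ((y / q : ℕ) : ℝ)
      then C * (Δ / q + 1 / boxLow (hi : ℝ) Δ l) else 0) ≤
      (if boxLow (hi : ℝ) Δ l < ((y / q : ℕ) : ℝ) ∧ ((y / q : ℕ) : ℝ) < boxHigh (hi : ℝ) Δ l
        then (1 : ℝ) else 0) * B := by
    intro l _
    split_ifs with h1 h2
    · rw [one_mul, hB]
      have hN := boxLow_gt_of_cut hΔ hΔ1 hq h1.1 h1.2.1
      have hNpos : 0 < boxLow (hi : ℝ) Δ l := lt_of_le_of_lt (by positivity) hN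
      have h3 : 1 / boxLow (hi : ℝ) Δ l ≤ 4 * q / y := by
        rw [div_le_div_iff₀ hNpos hy']
        rw [div_lt_iff₀ (by positivity)] at hN
        linarith
      exact mul_le_mul_of_nonneg_left (by linarith) hC
    · exact absurd ⟨h1.2.2, h1.2.1⟩ h2
    · rw [one_mul]; exact hB0
    · simp
  calc _ ≤ ∑ l ∈ range I', (if boxLow (hi : ℝ) Δ l < ((y / q : ℕ) : ℝ) ∧
          ((y / q : ℕ) : ℝ) < boxHigh (hi : ℝ) Δ l then (1 : ℝ) else 0) * B :=
        Finset.sum_le_sum hterm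
    _ = (#((range I').filter (fun l => boxLow (hi : ℝ) Δ l < ((y / q : ℕ) : ℝ) ∧
          ((y / q : ℕ) : ℝ) < boxHigh (hi : ℝ) Δ l)) : ℝ) * B := by
        rw [← Finset.sum_mul, Finset.sum_boole]
    _ ≤ 1 * B := by
        refine mul_le_mul_of_nonneg_right ?_ hB0
        exact_mod_cast card_filter_cut_le_one (T := (hi : ℝ)) (by exact_mod_cast hhi) hΔ.le _ _
    _ = B := one_mul B

end Summit.Parity.BatemanHorn.Theorems
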